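import Summits.ABC.ABC.Theses.CubicResolventAllowance
import Literature.NumberTheory.EllipticCurves.HeightConductorBoundsModularity
import Literature.NumberTheory.EllipticCurves.GlobalMinimalModel
import Literature.NumberTheory.EllipticCurves.GlobalMinimalModelProofs
import Literature.NumberTheory.DiophantineGeometry.MinimalDiscriminantProofs

/-!
# Stub ideation k=1 (RECOGNISE & IMPORT), gen 2 — `stub_complexCubic` of crux `IndexSzpiro` (stmt-ABC-22740)

Scratch namespace; nothing here is a tree proposal.  Elaboration sanity of the PROPOSED HELPER
LEMMAS of `STUB-IDEAS-stub_complexCubic-1.md` (this file: `STUB_IDEAS_stub_complexCubic_1_Sketch.lean`; the name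
`StubIdeas1Sketch.lean` belongs to the `stub_realCubic` k1 seat): statements with `sorry` bodies are proposals
(one prover cycle each); statements with real proofs are certified here.

* Part A (currency / conditional anchor): `H1`, `H1'`, `H2` (proved), `H2'` (proved), `H3`, `H3'`.
* Part B (ceiling import): `H4` (proved from the named fact).
* Part C (door): `H7`.
* Part E (NEW in gen 2 — binary cubic forms / Thue–Mahler currency, Bennett–Gherga–Rechnitzer 2019
  Thm 1, Math. Comp. 88, pp. 1345–1347): `E1` syzygy (proved), `E1'` (proved), `E2` (proved),
  `E2'` (proved), `E3` (proved), `E4` (vendored-fact SKETCH, to be re-read by a typer), `E5`, `Hj0`.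
-/

open Polynomial

namespace Summit.ABC.ABC.Cruxes.IndexSzpiro.StubIdeasComplexCubic1

open Literature.NumberTheory.EllipticCurves
open Summit.ABC.ABC.Theses.CubicResolventAllowance (IndexSzpiro)

/-- The target stub, verbatim (skeleton sha d34fb8f2…, `stub_complexCubic`). -/
def Stub : Prop :=
  ∀ ε : ℝ, 0 < ε → ∃ C : ℝ, ∀ (W : WeierstrassCurve ℚ) [W.IsElliptic] (K : Type) [Field K]
    [NumberField K], Irreducible W.twoTorsionPolynomial.toPoly → Module.finrank ℚ K = 3 →
    (∃ θ : K, aeval θ W.twoTorsionPolynomial.toPoly = 0) → NumberField.discr K < 0 →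
    (W.minimalDiscriminantNorm ℤ : ℝ) ≤
      C * |(NumberField.discr K : ℝ)| * (W.conductorNorm ℤ : ℝ) ^ (6 + ε)

/-- The three `K`-binders of the stub: `K ≅ ℚ[x]/(ψ_W)` is the cubic 2-division resolvent field. -/
def IsResolventField (W : WeierstrassCurve ℚ) (K : Type) [Field K] [NumberField K] : Prop :=
  Irreducible W.twoTorsionPolynomial.toPoly ∧ Module.finrank ℚ K = 3 ∧
    ∃ θ : K, aeval θ W.twoTorsionPolynomial.toPoly = 0

/-! ## Part A — currency and conditional anchor -/

/-- **H1 (M).** `Δ(W) = q² · d_K`: `disc ψ_W = 16 Δ` (Mathlib `WeierstrassCurve.twoTorsionPolynomial_discr`),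
`disc(1,θ,θ²) = disc(ψ_W)/lc⁴`-scaling, change of basis to an integral basis
(tree `Literature.NumberTheory.NumberFields.discr_powerBasis_eq_indexDet_sq_mul_discr`,
Cohen Prop. 4.4.4). -/
theorem H1_disc_ratio_sq (W : WeierstrassCurve ℚ) [W.IsElliptic] (K : Type) [Field K] [NumberField K]
    (h : IsResolventField W K) : ∃ q : ℚ, q ≠ 0 ∧ W.Δ = q ^ 2 * (NumberField.discr K : ℚ) := by
  sorry

/-- **H1' (S from H1).** The sign hypothesis of the stub is the sign class `Δ < 0` (`E(ℝ)` connected). -/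
theorem H1'_sign (W : WeierstrassCurve ℚ) [W.IsElliptic] (K : Type) [Field K] [NumberField K]
    (h : IsResolventField W K) : NumberField.discr K < 0 ↔ W.Δ < 0 := by
  sorry

/-- **H2 (S, PROVED).** Szpiro's conjecture implies the stub (`|d_K| ≥ 1`). The stub is a Szpiro WINDOW. -/
theorem H2_stub_of_szpiro (h : SzpiroConjecture) : Stub := by
  intro ε hε
  obtain ⟨C, hC⟩ := h ε hε
  refine ⟨max C 0, ?_⟩
  intro W _ K _ _ _ _ _ _
  have h1 := hC W
  have hN : (0 : ℝ) ≤ (W.conductorNorm ℤ : ℝ) ^ (6 + ε) := Real.rpow_nonneg (Nat.cast_nonneg _) _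
  have hd : (1 : ℝ) ≤ |(NumberField.discr K : ℝ)| := by
    have h0 : NumberField.discr K ≠ 0 := NumberField.discr_ne_zero K
    have : (1 : ℤ) ≤ |NumberField.discr K| := Int.one_le_abs h0
    rw [← Int.cast_abs]
    exact_mod_cast this
  have hmax : (0 : ℝ) ≤ max C 0 := le_max_right _ _
  calc (W.minimalDiscriminantNorm ℤ : ℝ) ≤ C * (W.conductorNorm ℤ : ℝ) ^ (6 + ε) := h1
    _ ≤ max C 0 * (W.conductorNorm ℤ : ℝ) ^ (6 + ε) :=
        mul_le_mul_of_nonneg_right (le_max_left _ _) hN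
    _ = max C 0 * 1 * (W.conductorNorm ℤ : ℝ) ^ (6 + ε) := by ring
    _ ≤ max C 0 * |(NumberField.discr K : ℝ)| * (W.conductorNorm ℤ : ℝ) ^ (6 + ε) := by
        gcongr

/-- **H2' (S, PROVED).** The crux implies the stub (drop the sign hypothesis). -/
theorem H2'_stub_of_indexSzpiro (h : IndexSzpiro) : Stub := by
  intro ε hε
  obtain ⟨C, hC⟩ := h ε hε
  exact ⟨C, fun W _ K _ _ hirr h3 hθ _ => hC W K hirr h3 hθ⟩

/-- **H3 (M).** The INDEX IDENTITY on a global minimal model: `2⁸ · Δ_min^± = I_E² · d_K`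
(`4θ₀` is a root of the monic integer cubic `X³ + b₂X² + 8b₄X + 16b₆` of discriminant `2⁸Δ`,
`disc ℤ[4θ₀] = [𝓞_K : ℤ[4θ₀]]² d_K`). Corollaries: `d_K ∣ 2⁸Δ_min`, `sign d_K = sign Δ`. -/
theorem H3_index_identity (W : WeierstrassCurve ℚ) [W.IsElliptic] [W.IsGloballyMinimal] (K : Type)
    [Field K] [NumberField K] (h : IsResolventField W K) :
    ∃ I : ℤ, I ≠ 0 ∧ (2 : ℤ) ^ 8 * W.minimalDiscriminantInt = I ^ 2 * NumberField.discr K := by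
  sorry

/-- The stub in INDEX currency on the complex class: `I_E² ≤ C · N^{6+ε}` (no `K`-discriminant left). -/
def IndexBoundNeg : Prop :=
  ∀ ε : ℝ, 0 < ε → ∃ C : ℝ, ∀ (W : WeierstrassCurve ℚ) [W.IsElliptic] [W.IsGloballyMinimal]
    (K : Type) [Field K] [NumberField K], IsResolventField W K → W.Δ < 0 →
    ∀ I : ℤ, (2 : ℤ) ^ 8 * W.minimalDiscriminantInt = I ^ 2 * NumberField.discr K →
      ((I : ℝ)) ^ 2 ≤ C * (W.conductorNorm ℤ : ℝ) ^ (6 + ε)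

/-- **H3' (M).** Index bound ⇒ stub (pass to a global minimal model — `hasGlobalMinimalModel_rat_holds` —
transport the root `θ ↦ u⁻²(θ − r)`, use model-invariance of `minimalDiscriminantNorm`/`conductorNorm`,
then `2⁸Δ_min = I²|d_K| ≤ C|d_K|N^{6+ε}`). -/
theorem H3'_stub_of_indexBound (h : IndexBoundNeg) : Stub := by
  sorry

/-! ## Part B — the ceiling in print, in the stub's currency -/

/-- **H4 (S, PROVED from the named fact).** von Känel 2014 Cor. 6.2 ⇒ `Δ_min ≤ exp(3N(log N)² + 124)` —
the only engine in print that USES `ℚ(E[2])` (vK Thm 3.3, λ-unit equation) is exponential. -/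
theorem H4_ceiling (h : ModularForms.vonKanel2014_log_minimalDiscriminant_le) (W : WeierstrassCurve ℚ) [W.IsElliptic] :
    (W.minimalDiscriminantNorm ℤ : ℝ) ≤
      Real.exp (3 * (W.conductorNorm ℤ : ℝ) * Real.log (W.conductorNorm ℤ) ^ 2 + 124) := by
  have h1 := h W
  have hpos : (0 : ℝ) < (W.minimalDiscriminantNorm ℤ : ℝ) := by
    exact_mod_cast WeierstrassCurve.minimalDiscriminantNorm_pos_holds W
  calc (W.minimalDiscriminantNorm ℤ : ℝ) = Real.exp (Real.log (W.minimalDiscriminantNorm ℤ : ℝ)) :=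
        (Real.exp_log hpos).symm
    _ ≤ Real.exp (3 * (W.conductorNorm ℤ : ℝ) * Real.log (W.conductorNorm ℤ) ^ 2 + 124) :=
        Real.exp_le_exp.mpr h1

/-! ## Part C — the sign-specific door (complex class ⇒ `ℚ(√Δ) = ℚ(√d_K)` imaginary quadratic, `Gal = S₃`) -/

/-- **H7 (M).** `√Δ ∈` any field over which `ψ_W` splits (`δ = 4·∏_{i<j}(e_i − e_j)`, `disc ψ = 16Δ`). -/
theorem H7_sqrt_disc_mem (L : Type) [Field L] [Algebra ℚ L] (W : WeierstrassCurve ℚ)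
    (h : (W.twoTorsionPolynomial.toPoly.map (algebraMap ℚ L)).Splits) :
    ∃ δ : L, δ ^ 2 = algebraMap ℚ L W.Δ := by
  sorry

/-! ## Part E (gen 2) — binary cubic forms / Thue–Mahler currency (BGR 2019, Thm 1) -/

section BinaryCubic

variable {R : Type*} [CommRing R]

/-- The binary cubic form `F(u,v) = a u³ + b u²v + c uv² + d v³`. -/
def bcF (a b c d u v : R) : R := a * u ^ 3 + b * u ^ 2 * v + c * u * v ^ 2 + d * v ^ 3

/-- Its Hessian covariant `H_F` (BGR p. 1345). -/
def bcH (a b c d u v : R) : R :=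
  (b ^ 2 - 3 * a * c) * u ^ 2 + (b * c - 9 * a * d) * u * v + (c ^ 2 - 3 * b * d) * v ^ 2

/-- Its cubic covariant `G_F` (Jacobian of `F` and `H`; BGR p. 1345). -/
def bcG (a b c d u v : R) : R :=
  (-27 * a ^ 2 * d + 9 * a * b * c - 2 * b ^ 3) * u ^ 3 +
    (-3 * b ^ 2 * c - 27 * a * b * d + 18 * a * c ^ 2) * u ^ 2 * v +
    (3 * b * c ^ 2 - 18 * b ^ 2 * d + 27 * a * c * d) * u * v ^ 2 +
    (-9 * b * c * d + 2 * c ^ 3 + 27 * a * d ^ 2) * v ^ 3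

/-- Its discriminant `D_F` (BGR (4)). -/
def bcDisc (a b c d : R) : R :=
  -27 * a ^ 2 * d ^ 2 + b ^ 2 * c ^ 2 + 18 * a * b * c * d - 4 * a * c ^ 3 - 4 * b ^ 3 * d

/-- **E1 (PROVED).** The covariant syzygy `4H³ = G² + 27·D_F·F²` (BGR (5)). -/
theorem E1_syzygy (a b c d u v : R) :
    4 * bcH a b c d u v ^ 3 = bcG a b c d u v ^ 2 + 27 * bcDisc a b c d * bcF a b c d u v ^ 2 := by
  unfold bcH bcG bcDisc bcF
  ring

/-- **E1' (PROVED).** `D_F` is Mathlib's `Cubic.discr` of `⟨a,b,c,d⟩`. -/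
theorem E1'_disc_eq (a b c d : R) : bcDisc a b c d = (⟨a, b, c, d⟩ : Cubic R).discr := by
  simp only [bcDisc, Cubic.discr]
  ring

/-- The Mordell / Rubin–Silverberg / BGR family `E_{F,u,v,D} : y² = x³ − 27D²H_F(u,v)x + 27D³G_F(u,v)`
(BGR (8) without the `3^{[β₀/3]}` twist). -/
def rsCurve (a b c d u v D : R) : WeierstrassCurve R :=
  { a₁ := 0, a₂ := 0, a₃ := 0, a₄ := -27 * D ^ 2 * bcH a b c d u v, a₆ := 27 * D ^ 3 * bcG a b c d u v }

/-- **E2 (PROVED).** `Δ(E_{F,u,v,D}) = 2⁴·3¹²·D⁶·D_F·F(u,v)²` — after the scaling `u = 1/6` this is BGR's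
`Δ_E = D⁶ D_F F(u,v)² / 256`: the minimal discriminant is `D_F × (Thue–Mahler value)²` up to `D⁶/2⁸`. -/
theorem E2_Δ_rsCurve (a b c d u v D : R) :
    (rsCurve a b c d u v D).Δ = 2 ^ 4 * 3 ^ 12 * D ^ 6 * bcDisc a b c d * bcF a b c d u v ^ 2 := by
  simp only [rsCurve, WeierstrassCurve.Δ, WeierstrassCurve.b₂, WeierstrassCurve.b₄, WeierstrassCurve.b₆,
    WeierstrassCurve.b₈, bcH, bcG, bcDisc, bcF]
  ring

/-- **E2' (PROVED).** `c₄(E_{F,u,v,D}) = 6⁴·D²·H_F(u,v)` (BGR: `c₄(E) = D² H_F(u,v)` after `u = 1/6`). -/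
theorem E2'_c₄_rsCurve (a b c d u v D : R) :
    (rsCurve a b c d u v D).c₄ = 6 ^ 4 * D ^ 2 * bcH a b c d u v := by
  simp only [rsCurve, WeierstrassCurve.c₄, WeierstrassCurve.b₂, WeierstrassCurve.b₄]
  ring

/-- **E3 (PROVED).** Root transport `F(θ,1) = 0 ⇒ X = 3aθ + b` is a root of `X³ − 3H_F(1,0)X − G_F(1,0)`
(BGR p. 1347, §3.1.2): the splitting field of `F(x,1)` is the 2-division field of `E_{F,1,0,1}`
(whose 2-division cubic is `4(x³ − 27H(1,0)x + 27G(1,0))`, roots `x = −3(3aθᵢ + b)`). -/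
theorem E3_root_transport (a b c d θ : R) :
    (3 * a * θ + b) ^ 3 - 3 * bcH a b c d 1 0 * (3 * a * θ + b) - bcG a b c d 1 0 =
      27 * a ^ 2 * bcF a b c d θ 1 := by
  unfold bcH bcG bcF
  ring

/-- **E3' (PROVED).** The same transport at the level of the 2-division polynomial of `E_{F,1,0,1}`. -/
theorem E3'_twoTorsion_eval (a b c d θ : R) :
    (rsCurve a b c d 1 0 1).twoTorsionPolynomial.toPoly.eval (-3 * (3 * a * θ + b)) =
      -(4 * 27 * 27) * a ^ 2 * bcF a b c d θ 1 := by
  simp only [rsCurve, WeierstrassCurve.twoTorsionPolynomial, Cubic.toPoly, WeierstrassCurve.b₂,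
    WeierstrassCurve.b₄, WeierstrassCurve.b₆, bcH, bcG, bcF, eval_add, eval_mul, eval_pow, eval_C, eval_X]
  ring

end BinaryCubic

/-- **E4 (vendored-fact SKETCH — to be re-read against BGR Thm 1, p. 1346, and (10), (14), (15) by a typer
before filing under `Literature/`).** For every `E/ℚ` with `j ≠ 0` there are an integral binary cubic form
`F = (a,b,c,d)`, coprime `u, v` and `D ≥ 1` with: `D_F ≠ 0`, `sign D_F = sign Δ_E`, `D_F ∣ 2⁴3⁵N`,
`D ∣ 72 N`, `F(u,v)` an `S`-unit for `S = primes of 6N`, `256·|Δ_min| = D⁶·|D_F|·F(u,v)²`, and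
`F(x,1)` has a root in a cubic field `K` iff `ψ_E` does (same 2-division resolvent field). -/
def BGRTheorem1 : Prop :=
  ∀ (W : WeierstrassCurve ℚ) [W.IsElliptic], W.j ≠ 0 →
    ∃ (a b c d u v : ℤ) (D : ℕ), IsCoprime u v ∧ 0 < D ∧ bcDisc a b c d ≠ 0 ∧
      (0 < bcDisc a b c d ↔ 0 < W.Δ) ∧
      (bcDisc a b c d ∣ 2 ^ 4 * 3 ^ 5 * (W.conductorNorm ℤ : ℤ)) ∧
      ((D : ℤ) ∣ 72 * (W.conductorNorm ℤ : ℤ)) ∧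
      (bcF a b c d u v ≠ 0 ∧ ∀ p : ℕ, p.Prime → (p : ℤ) ∣ bcF a b c d u v → p ∣ 6 * W.conductorNorm ℤ) ∧
      (256 * (W.minimalDiscriminantNorm ℤ : ℤ) = (D : ℤ) ^ 6 * |bcDisc a b c d| * bcF a b c d u v ^ 2) ∧
      (∀ (K : Type) [Field K] [NumberField K], Module.finrank ℚ K = 3 →
        ((∃ θ : K, aeval θ W.twoTorsionPolynomial.toPoly = 0) ↔
          ∃ θ : K, aeval θ (⟨(a : ℚ), b, c, d⟩ : Cubic ℚ).toPoly = 0))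

/-- Szpiro `6+ε` on the class `{j ≠ 0, Δ < 0, ψ irreducible}` written in THUE–MAHLER currency
(`D⁶·|D_F|·F(u,v)² ≤ 256·C·N^{6+ε}` for the BGR data). K-free; implies the stub (E5), and the stub implies
it back only up to the factor `|D_F|/|d_K| = [𝓞_K : R_F]² ≤ 3888 N` — the stub sits between
"TM-Szpiro(6+ε)" and "TM-value(6+ε)": polynomial Thue–Mahler, open for every irreducible `F`. -/
def TMSzpiroNeg : Prop :=
  ∀ ε : ℝ, 0 < ε → ∃ C : ℝ, ∀ (W : WeierstrassCurve ℚ) [W.IsElliptic], W.j ≠ 0 → W.Δ < 0 →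
    Irreducible W.twoTorsionPolynomial.toPoly →
    ∀ (a b c d u v : ℤ) (D : ℕ), IsCoprime u v →
      256 * (W.minimalDiscriminantNorm ℤ : ℤ) = (D : ℤ) ^ 6 * |bcDisc a b c d| * bcF a b c d u v ^ 2 →
      ((D : ℝ) ^ 6 * |(bcDisc a b c d : ℝ)| * (bcF a b c d u v : ℝ) ^ 2) ≤
        256 * C * (W.conductorNorm ℤ : ℝ) ^ (6 + ε)

/-- **Hj0 (M).** The `j = 0` class (excluded by BGR Thm 1) is Szpiro-trivial: potentially good reduction
everywhere, `v_p(Δ_min) ≤ 10 = 5·f_p` for `p ≥ 5`, `≤ 14` at `2`, `≤ 13` at `3` (`y² = x³ + k`, `k`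
sixth-power free) ⇒ `Δ_min ≤ 2⁴3³·N⁵` (any absolute constant suffices downstream). -/
theorem Hj0_szpiro_of_j_zero (W : WeierstrassCurve ℚ) [W.IsElliptic] (hj : W.j = 0) :
    (W.minimalDiscriminantNorm ℤ : ℝ) ≤ 432 * (W.conductorNorm ℤ : ℝ) ^ (5 : ℕ) := by
  sorry

/-- **E5 (S given E4, H1').** TM-Szpiro on the complex class + the `j = 0` lemma ⇒ the stub
(`|d_K| ≥ 1`; `sign`: H1'). This is the slot where ANY future polynomial Thue–Mahler theorem lands. -/
theorem E5_stub_of_tmSzpiro (hB : BGRTheorem1) (h : TMSzpiroNeg)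
    (hj0 : ∀ (W : WeierstrassCurve ℚ) [W.IsElliptic], W.j = 0 →
      (W.minimalDiscriminantNorm ℤ : ℝ) ≤ 432 * (W.conductorNorm ℤ : ℝ) ^ (5 : ℕ))
    (h1' : ∀ (W : WeierstrassCurve ℚ) [W.IsElliptic] (K : Type) [Field K] [NumberField K],
      IsResolventField W K → (NumberField.discr K < 0 ↔ W.Δ < 0)) : Stub := by
  sorry

/-! ## Assembly map (which helper closes what)
* `H2 ∘ SzpiroConjecture` closes the stub conditionally (PROVED); `H2'` from the crux (PROVED).
* Unconditionally nothing closes: `{H1', H3, H3'}` ⇒ `Stub ↔ IndexBoundNeg`-type restatement;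
  `{E4, E5, Hj0, H1'}` ⇒ `TMSzpiroNeg → Stub` (Thue–Mahler currency); `H4` = exponential ceiling. -/

end Summit.ABC.ABC.Cruxes.IndexSzpiro.StubIdeasComplexCubic1
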